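import Summits.Langlands.Langlands.Theses.RamifiedCoefficientSeed
import Summits.Langlands.Langlands.Theorems.RamifiedCoefficientSeedAdjointSeedFromDualityStubResidualDualReduction
import Summits.Langlands.Langlands.Theorems.RamifiedCoefficientSeedAdjointSeedFromDualityStubSymmetricSimilitudeForm
import Summits.Langlands.Langlands.Theorems.RamifiedCoefficientSeedAdjointSeedFromDualityStubAdSurjectiveOfSplitForm
import Summits.Langlands.Langlands.Theorems.RamifiedCoefficientSeedAdjointSeedFromDualityStubTwistedAdjointOfGO3
import Summits.Langlands.Langlands.Theorems.RamifiedCoefficientSeedAdjointSeedFromDualityStubOddOfConjugationTrace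
import Summits.Langlands.Langlands.Theorems.RamifiedCoefficientSeedAdjointSeedFromDualityStubSeedOfExactOddLift
import Literature.NumberTheory.GaloisRepresentations.AbsolutelyIrreducibleReduction
import Literature.RingTheory.Valuation.AlgClosedResidue

/-!
# `AdjointSeedFromDuality` modulo the lifting engine (route `RamifiedCoefficientSeed`, crux stmt-Langlands-16780)

Assembly of line `birth` (Cruxes/AdjointSeedFromDuality/Lines/birth.lean): the route decl
`Summit.Langlands.Langlands.Theses.RamifiedCoefficientSeed.AdjointSeedFromDuality` — for `p ≥ 5` and
`ρ : Γ_ℚ → GL₃(ℚ̄_p)` residually essentially self-dual in trace form, residually absolutely irreducible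
on `Γ_{ℚ(ζ_p)}`, with a complex conjugation of trace `±1`, there are an ODD `ρ₀ : Γ_ℚ → GL₂(ℚ̄_p)` and a
character `η` with `‖tr ρ(σ) − η(σ)(tr ρ₀(σ)²/det ρ₀(σ) − 1)‖ < 1` — is proved from the six landed stubs
A `stub_residualDualReduction`, B `stub_symmetricSimilitudeForm`, C `stub_adSurjectiveOfSplitForm`,
D `stub_twistedAdjointOfGO3`, E `stub_oddOfConjugationTrace`, F `stub_seedOfExactOddLift`, MODULO the
one remaining input, stated here as an explicit hypothesis: the LIFTING ENGINE (stub G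
`stub_exactOddLift`) — every odd, absolutely irreducible `τ̄ : Γ_ℚ → GL₂(ℤ̄_p/𝔪)` with open kernel is
a reduction of a continuous `ρ₀ : Γ_ℚ → GL₂(ℚ̄_p)`.  This is Serre's modularity conjecture in the
"arises from a newform" form of Khare–Wintenberger (Invent. Math. 178 (2009), (I) §1 and Thm. 1.2,
Thm. 9.1 with Kisin's Hypothesis (H)), read through the fixed `ℚ̄ ↪ ℚ̄_p`; for `p ∤ |im τ̄|` it is the
Teichmüller/Schur–Zassenhaus lift (Serre, LRFG §15.5 Prop. 43), for `p ≥ 7` also Ramakrishna,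
Ann. of Math. 156 (2002) Thm. 1(b).  The crux therefore stands CLOSED MODULO that named fact.
-/

set_option linter.dupNamespace false -- `Summit.Langlands.Langlands` is the mandated namespace

namespace Summit.Langlands.Langlands.Theorems

open scoped MatrixGroups
open Summit.Langlands.Langlands.Theses.RamifiedCoefficientSeed
open Summit.Langlands.Langlands.Cruxes.AdjointSeedFromDuality.Birth
open Literature.NumberTheory.GaloisRepresentations

/-- `ℤ̄_p/𝔪` has characteristic `p` (`‖p‖ = 1/p < 1`, so `p ∈ 𝔪`;
`Literature.RingTheory.Valuation.charP_residueField`). [folklore] -/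
theorem RamifiedCoefficientSeed.charP_padicAlgClResidueField (p : ℕ) [Fact p.Prime] :
    CharP (padicAlgClResidueField p) p := by
  refine Literature.RingTheory.Valuation.charP_residueField (padicAlgClIntegers p) ?_
  rw [mem_maximalIdeal_iff_norm_lt_one (padicAlgCl_mem_valuationSubring_iff p)]
  have e : (((p : ℕ) : padicAlgClIntegers p) : PadicAlgCl p) = (p : PadicAlgCl p) := by simp
  rw [e, ← PadicAlgCl.valuation_coe, PadicAlgCl.valuation_p]
  have hp : (1 : ℝ) < p := by exact_mod_cast (Fact.out : p.Prime).one_lt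
  rw [NNReal.coe_div, NNReal.coe_one, NNReal.coe_natCast]
  exact (div_lt_one (by linarith)).2 hp

/-- In `ℤ̄_p/𝔪` with `p ≥ 5` (indeed `p ≠ 2`), `2 ≠ 0`. [folklore] -/
theorem RamifiedCoefficientSeed.two_ne_zero_padicAlgClResidueField (p : ℕ) [Fact p.Prime]
    (hp : 5 ≤ p) : (2 : padicAlgClResidueField p) ≠ 0 := by
  haveI := RamifiedCoefficientSeed.charP_padicAlgClResidueField p
  intro h
  have h' : ((2 : ℕ) : padicAlgClResidueField p) = 0 := by exact_mod_cast h
  rw [CharP.cast_eq_zero_iff (padicAlgClResidueField p) p 2] at h'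
  have := Nat.le_of_dvd (by norm_num) h'
  omega

/-- **`AdjointSeedFromDuality` from the lifting engine.**  The route decl
`Summit.Langlands.Langlands.Theses.RamifiedCoefficientSeed.AdjointSeedFromDuality` follows from the six
landed stubs of line `birth` and the hypothesis `hlift` — the statement of the registered stub
`stub_exactOddLift`: for `p ≥ 5`, every `τ̄ : Γ_ℚ → GL₂(ℤ̄_p/𝔪)` with open kernel, absolutely
irreducible and odd at some complex conjugation, is a reduction (`IsReductionOf` along `RingHom.id`)
of some continuous `ρ₀ : Γ_ℚ → GL₂(ℚ̄_p)`.  Composition: A (reduction `ρ̄`, open kernel, absolutely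
irreducible; residual multiplier `ν̄` with `tr ρ̄(σ) = ν̄(σ) tr ρ̄(σ⁻¹)`) → B (symmetric similitude
form `A`) → C + D (`tr ρ̄ = ψ̄ · (tr τ̄²/det τ̄ − 1)` via `SO₃ = Ad(GL₂)` and Tate's lifting theorem) →
E (`det τ̄(c) = −1`) → `hlift` (exact lift `ρ₀`) → F (`ρ₀` odd, Teichmüller `η`, congruence).
[cite: KhareWintenberger2009, §1, Thm. 1.2 and Thm. 9.1] [folklore] -/
theorem RamifiedCoefficientSeed.adjointSeedFromDuality_of_exactOddLift
    (hlift : ∀ (p : ℕ) [Fact p.Prime], 5 ≤ p →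
      ∀ τbar : Field.absoluteGaloisGroup ℚ →* GL (Fin 2) (padicAlgClResidueField p),
        IsOpen ((τbar.ker : Subgroup (Field.absoluteGaloisGroup ℚ)) :
          Set (Field.absoluteGaloisGroup ℚ)) →
        IsAbsIrreducible τbar →
        (∃ (φ : ℚ →+* ℝ) (c : Field.absoluteGaloisGroup ℚ),
          IsComplexConjugation φ c ∧ Matrix.GeneralLinearGroup.det (τbar c) = -1) →
        ∃ ρ₀ : FramedGaloisRep ℚ (PadicAlgCl p) 2,
          ρ₀.IsReductionOf (RingHom.id (padicAlgClResidueField p)) τbar) :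
    AdjointSeedFromDuality := by
  intro p _ hp ρ hdual hirr hconj
  haveI : IsAlgClosed (padicAlgClResidueField p) :=
    Literature.RingTheory.Valuation.isAlgClosed_residueField (padicAlgClIntegers p)
  have h2 := RamifiedCoefficientSeed.two_ne_zero_padicAlgClResidueField p hp
  -- A: reduction `ρ̄` (open kernel, absolutely irreducible) and the trace duality with `ν̄`
  obtain ⟨ρbar, νbar, hred, hρopen, hρirr, htr⟩ := stub_residualDualReduction p ρ hdual hirr
  -- B: symmetric similitude form
  obtain ⟨A, hsymm, hdet, hGO⟩ := stub_symmetricSimilitudeForm h2 ρbar νbar hρirr htr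
  -- C + D: `ρ̄ ≅ ψ̄ ⊗ Ad(τ̄)` in trace form
  obtain ⟨τbar, ψbar, hτopen, hτirr, hψopen, had⟩ :=
    stub_twistedAdjointOfGO3 p h2 ρbar νbar A hρopen hρirr hsymm hdet hGO
      (stub_adSurjectiveOfSplitForm h2 A hsymm hdet)
  -- the complex conjugation of trace `±1`; E: `τ̄` is odd at `c`
  obtain ⟨φ, c, hc, htrc⟩ := hconj
  have hoddc := stub_oddOfConjugationTrace p h2 ρ ρbar τbar ψbar hred had φ c hc htrc
  -- the lifting engine: exact characteristic-zero lift of `τ̄`; F: the seed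
  obtain ⟨ρ₀, hρ₀⟩ := hlift p hp τbar hτopen hτirr ⟨φ, c, hc, hoddc⟩
  obtain ⟨η, hodd, hcong⟩ :=
    stub_seedOfExactOddLift p hp ρ ρbar τbar ψbar hred hψopen had φ c hc hoddc ρ₀ hρ₀
  exact ⟨ρ₀, η, hodd, hcong⟩

end Summit.Langlands.Langlands.Theorems
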